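import Mathlib
import HarnessLib
import Summits.RiemannHypothesis.RiemannHypothesis.Theorems.ScrewLemmaKCoprofileDefs

/-!
# Route `ScrewLemmaKExtremalRay` (L24 «EXTREMAL RAY») — the objects of crux E1
# `NearExtremalGenerators` (stmt-RiemannHypothesis-22262)

* `gramRay t = 1 − (10/3)√t + (5/2)t` — the GRAM RAY of K3 (`MomentGramFloor`): the first row
  `(36, −120, 90)/36` of the inverse Cauchy/Hilbert Gram matrix of `1, √t, t` on `(0,1)`
  (`∫₀¹ r = ∫₀¹ r² = 1/36`, `r ⊥ √t`, `r ⊥ t`);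
* `coprofileOp φ t = Σ_{n ≤ 1/t} φ(nt)/n` — the DILATION OPERATOR `A` of the route card; the lattice
  co-profile is `Φ_g = A(g′)` (`latticeCoprofile_eq_coprofileOp`, by `rfl`);
* `moebiusRay u = Σ_{n ≤ 1/u} μ(n) r(nu)/n` — the MÖBIUS GENERATOR `φ*` with `Aφ* = r` exactly on
  `(0,1]` (Möbius inversion; proved in `Theorems/ScrewLemmaKExtremalRayMoebius.lean`).

Definitions + the linearity of `A` only.  RH-free; nothing here bears on the truth of RH.
-/

set_option linter.dupNamespace false

noncomputable section

namespace Summit.RiemannHypothesis.RiemannHypothesis.Theorems.ScrewLemmaKExtremalRay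

open Summit.RiemannHypothesis.RiemannHypothesis.Theorems.ScrewLemmaKCoprofile (latticeCoprofile)

/-- The GRAM RAY `r(t) = 1 − (10/3)√t + (5/2)t` (extremal direction of K3's Gram floor). [folklore] -/
def gramRay (t : ℝ) : ℝ := 1 - 10 / 3 * Real.sqrt t + 5 / 2 * t

/-- The DILATION OPERATOR `(Aφ)(t) = Σ_{n ≤ 1/t} φ(nt)/n`. [folklore] -/
def coprofileOp (φ : ℝ → ℝ) (t : ℝ) : ℝ := ∑ n ∈ Finset.Icc 1 ⌊1 / t⌋₊, φ (n * t) / n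

/-- The MÖBIUS GENERATOR `φ*(u) = Σ_{n ≤ 1/u} μ(n) r(nu)/n`. [folklore] -/
def moebiusRay (u : ℝ) : ℝ :=
  ∑ n ∈ Finset.Icc 1 ⌊1 / u⌋₊, (ArithmeticFunction.moebius n : ℝ) * gramRay (n * u) / n

/-- `Φ_g = A(g′)` (definitional). [folklore] -/
theorem latticeCoprofile_eq_coprofileOp (g : ℝ → ℝ) :
    latticeCoprofile g = coprofileOp (deriv g) := rfl

/-- `A` is additive. [folklore] -/
theorem coprofileOp_add (φ ψ : ℝ → ℝ) (t : ℝ) :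
    coprofileOp (fun u => φ u + ψ u) t = coprofileOp φ t + coprofileOp ψ t := by
  unfold coprofileOp
  rw [← Finset.sum_add_distrib]
  refine Finset.sum_congr rfl fun n _ => ?_
  ring

/-- `A` commutes with subtraction. [folklore] -/
theorem coprofileOp_sub (φ ψ : ℝ → ℝ) (t : ℝ) :
    coprofileOp (fun u => φ u - ψ u) t = coprofileOp φ t - coprofileOp ψ t := by
  unfold coprofileOp
  rw [← Finset.sum_sub_distrib]
  refine Finset.sum_congr rfl fun n _ => ?_
  ring

/-- `A` is homogeneous. [folklore] -/
theorem coprofileOp_const_mul (c : ℝ) (φ : ℝ → ℝ) (t : ℝ) :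
    coprofileOp (fun u => c * φ u) t = c * coprofileOp φ t := by
  unfold coprofileOp
  rw [Finset.mul_sum]
  refine Finset.sum_congr rfl fun n _ => ?_
  ring

/-- `A φ` depends only on the values of `φ` on `(0,1]` when `t ∈ (0,1]`: if `φ = ψ` on `(0,1]`
then `Aφ(t) = Aψ(t)` for `0 < t`. [folklore] -/
theorem coprofileOp_congr {φ ψ : ℝ → ℝ} (h : ∀ u ∈ Set.Ioc (0:ℝ) 1, φ u = ψ u) {t : ℝ}
    (ht : 0 < t) : coprofileOp φ t = coprofileOp ψ t := by
  unfold coprofileOp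
  refine Finset.sum_congr rfl fun n hn => ?_
  rw [Finset.mem_Icc] at hn
  have hn1 : (1:ℝ) ≤ n := by exact_mod_cast hn.1
  have hnt : (n:ℝ) * t ∈ Set.Ioc (0:ℝ) 1 := by
    refine ⟨by positivity, ?_⟩
    have h2 : (n:ℝ) ≤ ⌊1 / t⌋₊ := by exact_mod_cast hn.2
    have h3 : (⌊1 / t⌋₊ : ℝ) ≤ 1 / t := Nat.floor_le (by positivity)
    calc (n:ℝ) * t ≤ (1 / t) * t := mul_le_mul_of_nonneg_right (h2.trans h3) ht.le
      _ = 1 := by field_simp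
  rw [h _ hnt]

end Summit.RiemannHypothesis.RiemannHypothesis.Theorems.ScrewLemmaKExtremalRay

end
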